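/-
Origin: expansion seat `planner-pub-hodgecm-mc-axioms-1-g14-0`, handover #W110 2026-08-20T15:53:55Z md5 f8ba3bffd387 (PKG 6aff476445de → f8ba3bffd387; 246 l.; MECHANICAL (iib-R) rewrite v3.1 of the PKG file as it stands (55 token edits; rules R1x2+RX[h₂']x53)) (`HOME/mc/pub-hodgecm-mc-axioms-1-g14/revendor/kit-r55/stage55/HodgeCM/Model/ThetaHolPin.lean`, md5 f8ba3bffd387, 246 lines);
landed by the gen-22 packager (p-g22) in gate run 55 REPLACES the earlier landed copy of `HodgeCM/Model/ThetaHolPin.lean` (seat copy carried the packager Origin header of an earlier run (stripped)).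
-/
/-
Copyright (c) 2026. Released under Apache 2.0 license as described in the file LICENSE.
Cell pub-hodgecm, MODEL layer (construction prover mc-autform-2, gen 5), node W6b-hol of `MODEL-DAG.md`,
(AUT) half at the PIN: the `hol` junction — holomorphy of restricted theta forms from first-order
archimedean differentiability with complex-linear differential along `𝔭` (equivalently: archimedean
smoothness and the Cauchy–Riemann relation of the Lie derivatives).
-/
import Summits.HodgeConjecture.HodgeCM.Model.ThetaSpaceInputPin_2
import Literature.AlgebraicGeometry.ShimuraVarieties.UnitaryBallHolomorphyCriterion
import Literature.AlgebraicGeometry.ShimuraVarieties.UnitaryBallLieDerivative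

/-!
# The `hol` junction at the pin (node W6b-hol, (AUT) ⟶ (ASM))

E's supply binder asks, per product `K`-type datum `B` (`Model/SupplySituation`), for
`hol : ∀ f ∈ (X.P k).weightFunctions, B.restrictedThetaForm f ∈ (X.D B.Γ₀).Hol`.
At the pin `X := thetaSpaceInputIn hHD hI h₁ h₃ S h` (`Model/ThetaSpaceInputPin`) the target
`(X.D Γ).Hol` IS (`rfl`, `Model.classMapDatumOf_Hol`) the space of HOLOMORPHIC weight forms
`BallForms.holWeightForms (levelImage … Γ h) BallForms.isPullbackCocycle_cotangentCocycle` on `U(2,1)`,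
and `B.restrictedThetaForm f` IS (`rfl`) the archimedean restriction
`restrictHom (X.ιinf B.Γ₀) … (B.thetaFormOf f)` of the adelic theta form of the one test family against `f`.

This file discharges `hol` from the remaining analytic input on that adelic theta form `F`
(read as the `ℂ²`-valued function `B.thetaFunIn f` on `G_U(𝔸)`), in two interchangeable shapes:

* FIRST-ORDER shape (`…_of_differentiableAt`, tree criterion
  `Vendored/H21/…/UnitaryBallHolomorphyCriterion`): for every `y ∈ G_U(𝔸)` the function
  `b ↦ F (y · ιinf (expP b))` (`expP b = exp X_b`, `X_b ∈ 𝔭 ⊂ 𝔲(2,1)`, `Vendored/H21/…/UnitaryBallCauchyRiemann`)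
  is real-differentiable at `b = 0` (`hd`, lane (AN): termwise differentiation of the theta series) and its
  differential `D` is complex-linear, `D(iv) = i·D(v)` (`hlin`, lanes (REP)+(ASM): the vacuum / degree-one
  vectors are killed by `𝔭₋` in the Fock model);
* LIE-DERIVATIVE shape (`…_of_lieDeriv`, tree criterion `Vendored/H21/…/UnitaryBallLieDerivative`):
  each component is archimedean-smooth through `X.ιinf B.Γ₀` (`IsArchSmooth (H := BallForms.u21Group) …`,
  `Vendored/H21/…/ArchimedeanCalculus`) and the Lie derivatives along `X_b := BallForms.liePMat b` satisfy
  `X_{ib}·F = i·X_b·F` (annihilation by `𝔭₋ = {X_b + i X_{ib}}`, lower-left block — orientation pin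
  `Vendored/H21/…/UnitaryBallPSplit` / SAN-13).

Main results: `thetaSpaceInputIn_D_Hol` (`rfl`); `restrictHom_mem_D_Hol_thetaSpaceInputIn_of_differentiableAt`,
`restrictHom_mem_D_Hol_thetaSpaceInputIn` (any adelic weight form); `ProductKTypeData.thetaFormOf` /
`restrictedThetaForm_eq` (`rfl`) / `thetaFunIn`; and E's `hol` per `f` at the pin:
**`ProductKTypeData.restrictedThetaForm_mem_Hol_of_differentiableAt`** and
**`ProductKTypeData.restrictedThetaForm_mem_Hol_of_lieDeriv`**.

Nothing is cited and nothing is minted: kernel lemmas over the installed definitions.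
-/

set_option autoImplicit false

noncomputable section

open MulAction
open Literature.Geometry.ComplexHyperbolic.BallModel (U21 Ball x₀)
open Literature.NumberTheory.Automorphic Literature.NumberTheory.Weil1964
open Literature.NumberTheory.Automorphic.WeightForms (ClassMapDatum thetaClasses restrictHom IsLevelCorrected
  IsWeightMatched)
open Literature.AlgebraicGeometry.HodgeTheory
open Literature.AlgebraicGeometry.ShimuraVarieties
open Literature.NumberTheory.Automorphic.PicardCM
open HodgeCM.Model.SupplyResidual
open HodgeCM.Model.ThetaSpace

namespace HodgeCM
namespace Model

section Pin

variable (hHD : exists_isReal_hodgeModel) (hI : hodgePQ_independent_of_hodgeModel)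
  (h₁ : BallQuotientUniformised)  (h₃ : CMAbelianVarietyRealised)

variable {L : CMField} {ι₁ : L →+* ℂ} {V : HermSpace3 L ι₁} {c : SeesawCtx L}

/-- At the pin, `Hol` of the class-map datum `D Γ` is the space of holomorphic weight forms of level
`levelImage … Γ h` for the cotangent cocycle (`rfl`). -/
theorem thetaSpaceInputIn_D_Hol (S : ThetaAdelicSide V c) (h : IsAnisotropic L V.Hm) (Γ : Level V) :
    ((thetaSpaceInputIn hHD hI h₁ h₃ S h).D Γ).Hol =
      BallForms.holWeightForms (levelImage hHD hI h₁ h₃ Γ h)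
        BallForms.isPullbackCocycle_cotangentCocycle :=
  rfl

/-- **The junction, first-order shape, for any adelic weight form.** At the pin, the archimedean
restriction along `ιinf Γ : U(2,1) →* G_U(𝔸)` of a weight form `F` on `G_U(𝔸)` lies in `(X.D Γ).Hol` as
soon as, for every `y ∈ G_U(𝔸)`, `b ↦ F (y · ιinf Γ (expP b))` is real-differentiable at `b = 0` with
complex-linear differential. -/
theorem restrictHom_mem_D_Hol_thetaSpaceInputIn_of_differentiableAt (S : ThetaAdelicSide V c)
    (h : IsAnisotropic L V.Hm) (Γ : Level V) {Kc : Type*} [Group Kc]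
    {ΓU : Subgroup (thetaSpaceInputIn hHD hI h₁ h₃ S h).GU}
    {κ : Kc →* (thetaSpaceInputIn hHD hI h₁ h₃ S h).GU} {τ : Representation ℂ Kc (Fin 2 → ℂ)}
    (hΔ : IsLevelCorrected ΓU κ τ ((thetaSpaceInputIn hHD hI h₁ h₃ S h).ιinf Γ)
      ((thetaSpaceInputIn hHD hI h₁ h₃ S h).Δ Γ))
    {η₁ : stabilizer U21 x₀ →* Kc}
    (hη : IsWeightMatched κ τ ((thetaSpaceInputIn hHD hI h₁ h₃ S h).ιinf Γ) (stabilizer U21 x₀).subtype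
      (BallForms.isPullbackCocycle_cotangentCocycle.weightOf x₀) η₁)
    (F : weightForms ΓU κ τ)
    (hd : ∀ y : (thetaSpaceInputIn hHD hI h₁ h₃ S h).GU,
      DifferentiableAt ℝ
        (fun b : Fin 2 → ℂ => (F : (thetaSpaceInputIn hHD hI h₁ h₃ S h).GU → (Fin 2 → ℂ))
          (y * (thetaSpaceInputIn hHD hI h₁ h₃ S h).ιinf Γ (BallForms.expP b))) 0)
    (hlin : ∀ (y : (thetaSpaceInputIn hHD hI h₁ h₃ S h).GU) (v : Fin 2 → ℂ),
      fderiv ℝ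
          (fun b : Fin 2 → ℂ => (F : (thetaSpaceInputIn hHD hI h₁ h₃ S h).GU → (Fin 2 → ℂ))
            (y * (thetaSpaceInputIn hHD hI h₁ h₃ S h).ιinf Γ (BallForms.expP b))) 0 (Complex.I • v) =
        Complex.I •
          fderiv ℝ
            (fun b : Fin 2 → ℂ => (F : (thetaSpaceInputIn hHD hI h₁ h₃ S h).GU → (Fin 2 → ℂ))
              (y * (thetaSpaceInputIn hHD hI h₁ h₃ S h).ιinf Γ (BallForms.expP b))) 0 v) :
    restrictHom ((thetaSpaceInputIn hHD hI h₁ h₃ S h).ιinf Γ) hΔ hη F ∈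
      ((thetaSpaceInputIn hHD hI h₁ h₃ S h).D Γ).Hol :=
  BallForms.restrictHom_mem_holWeightForms_of_differentiableAt_mul _ hΔ hη F hd hlin

/-- **The junction, Lie-derivative shape, for any adelic weight form.** At the pin, the archimedean
restriction along `ιinf Γ : U(2,1) →* G_U(𝔸)` of a weight form `F` on `G_U(𝔸)` lies in `(X.D Γ).Hol` as
soon as its components are archimedean-smooth through `ιinf Γ` and their Lie derivatives along `𝔭`
satisfy the Cauchy–Riemann relation `X_{ib}·F = i·X_b·F` (annihilation by `𝔭₋`). -/
theorem restrictHom_mem_D_Hol_thetaSpaceInputIn (S : ThetaAdelicSide V c) (h : IsAnisotropic L V.Hm)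
    (Γ : Level V) {Kc : Type*} [Group Kc]
    {ΓU : Subgroup (thetaSpaceInputIn hHD hI h₁ h₃ S h).GU}
    {κ : Kc →* (thetaSpaceInputIn hHD hI h₁ h₃ S h).GU} {τ : Representation ℂ Kc (Fin 2 → ℂ)}
    (hΔ : IsLevelCorrected ΓU κ τ ((thetaSpaceInputIn hHD hI h₁ h₃ S h).ιinf Γ)
      ((thetaSpaceInputIn hHD hI h₁ h₃ S h).Δ Γ))
    {η₁ : stabilizer U21 x₀ →* Kc}
    (hη : IsWeightMatched κ τ ((thetaSpaceInputIn hHD hI h₁ h₃ S h).ιinf Γ) (stabilizer U21 x₀).subtype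
      (BallForms.isPullbackCocycle_cotangentCocycle.weightOf x₀) η₁)
    (F : weightForms ΓU κ τ)
    (hs : ∀ j : Fin 2, IsArchSmooth (H := BallForms.u21Group)
      ((thetaSpaceInputIn hHD hI h₁ h₃ S h).ιinf Γ)
      fun x => (F : (thetaSpaceInputIn hHD hI h₁ h₃ S h).GU → (Fin 2 → ℂ)) x j)
    (hCR : ∀ (x : (thetaSpaceInputIn hHD hI h₁ h₃ S h).GU) (b : Fin 2 → ℂ) (j : Fin 2),
      lieDeriv (H := BallForms.u21Group) ((thetaSpaceInputIn hHD hI h₁ h₃ S h).ιinf Γ)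
          (BallForms.liePMat (Complex.I • b))
          (fun y => (F : (thetaSpaceInputIn hHD hI h₁ h₃ S h).GU → (Fin 2 → ℂ)) y j) x =
        Complex.I *
          lieDeriv (H := BallForms.u21Group) ((thetaSpaceInputIn hHD hI h₁ h₃ S h).ιinf Γ)
            (BallForms.liePMat b)
            (fun y => (F : (thetaSpaceInputIn hHD hI h₁ h₃ S h).GU → (Fin 2 → ℂ)) y j) x) :
    restrictHom ((thetaSpaceInputIn hHD hI h₁ h₃ S h).ιinf Γ) hΔ hη F ∈
      ((thetaSpaceInputIn hHD hI h₁ h₃ S h).D Γ).Hol :=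
  BallForms.restrictHom_mem_holWeightForms _ hΔ hη F hs hCR

end Pin

namespace ProductKTypeData

variable {U : Universe} {Lc : CMField} {ι₁ : Lc →+* ℂ} {V : HermSpace3 Lc ι₁} {c : SeesawCtx Lc}
variable {X : ThetaSpaceInput U V c} {k : Fin 4} {N : ℕ} (B : ProductKTypeData X k N)

/-- The adelic theta form of the one test family of `B` against the weight function `f`
(the form whose archimedean restriction is `B.restrictedThetaForm f`). -/
def thetaFormOf (f : C(relNormOneIdeles X.K X.L ⧸ relNormOneRat X.K X.L, ℂ)) :
    weightForms (X.P k).ΓU B.kappa B.tau :=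
  (X.P k).kernelDatum.thetaForm (probHaarRelNormOneQuot X.K X.L) (X.P k).kernelDatum_thetaLinear B.kappa
    B.jFam B.isThetaEquivariant_family LinearMap.id B.tau_dual_apply f

/-- `B.restrictedThetaForm f` is the archimedean restriction of `B.thetaFormOf f` (`rfl`). -/
theorem restrictedThetaForm_eq (f : C(relNormOneIdeles X.K X.L ⧸ relNormOneRat X.K X.L, ℂ)) :
    B.restrictedThetaForm f =
      restrictHom (X.ιinf B.Γ₀) B.isLevelCorrected B.isWeightMatched (B.thetaFormOf f) :=
  rfl

end ProductKTypeData

section PinHol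

variable (hHD : exists_isReal_hodgeModel) (hI : hodgePQ_independent_of_hodgeModel)
  (h₁ : BallQuotientUniformised)  (h₃ : CMAbelianVarietyRealised)

variable {L : CMField} {ι₁ : L →+* ℂ} {V : HermSpace3 L ι₁} {c : SeesawCtx L}

variable {hHD hI h₁ h₃} in
/-- At the pin (`W = Fin 2 → ℂ`), the adelic theta form `B.thetaFormOf f` read as a `ℂ²`-valued FUNCTION
on `G_U(𝔸)` — the object the analytic hypotheses `hd` / `hlin` / `hs` / `hCR` are about. -/
def ProductKTypeData.thetaFunIn {S : ThetaAdelicSide V c} {h : IsAnisotropic L V.Hm} {k : Fin 4} {N : ℕ}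
    (B : ProductKTypeData (thetaSpaceInputIn hHD hI h₁ h₃ S h) k N)
    (f : C(relNormOneIdeles (NumberField.maximalRealSubfield L) L ⧸
      relNormOneRat (NumberField.maximalRealSubfield L) L, ℂ)) :
    (thetaSpaceInputIn hHD hI h₁ h₃ S h).GU → (Fin 2 → ℂ) :=
  fun y => (B.thetaFormOf f).1 y

variable {hHD hI h₁ h₃} in
/-- `B.thetaFunIn f y = (B.thetaFormOf f) y` (`rfl`). -/
theorem ProductKTypeData.thetaFunIn_apply {S : ThetaAdelicSide V c} {h : IsAnisotropic L V.Hm}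
    {k : Fin 4} {N : ℕ} (B : ProductKTypeData (thetaSpaceInputIn hHD hI h₁ h₃ S h) k N)
    (f : C(relNormOneIdeles (NumberField.maximalRealSubfield L) L ⧸
      relNormOneRat (NumberField.maximalRealSubfield L) L, ℂ))
    (y : (thetaSpaceInputIn hHD hI h₁ h₃ S h).GU) :
    B.thetaFunIn f y = (B.thetaFormOf f).1 y :=
  rfl

/-- **E's `hol` at the pin, per weight function — first-order shape** (node W6b-hol): for a product
`K`-type datum `B` over the pinned theta-space input, `B.restrictedThetaForm f ∈ (X.D B.Γ₀).Hol` follows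
from: for every `y ∈ G_U(𝔸)`, `b ↦ (B.thetaFunIn f) (y · ιinf B.Γ₀ (expP b))` is real-differentiable at
`b = 0` (`hd`, (AN)) and its differential is complex-linear (`hlin`, (REP)+(ASM): annihilation by `𝔭₋`). -/
theorem ProductKTypeData.restrictedThetaForm_mem_Hol_of_differentiableAt (S : ThetaAdelicSide V c)
    (h : IsAnisotropic L V.Hm) {k : Fin 4} {N : ℕ}
    (B : ProductKTypeData (thetaSpaceInputIn hHD hI h₁ h₃ S h) k N)
    (f : C(relNormOneIdeles (NumberField.maximalRealSubfield L) L ⧸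
      relNormOneRat (NumberField.maximalRealSubfield L) L, ℂ))
    (hd : ∀ y : (thetaSpaceInputIn hHD hI h₁ h₃ S h).GU,
      DifferentiableAt ℝ
        (fun b : Fin 2 → ℂ =>
          B.thetaFunIn f (y * (thetaSpaceInputIn hHD hI h₁ h₃ S h).ιinf B.Γ₀ (BallForms.expP b))) 0)
    (hlin : ∀ (y : (thetaSpaceInputIn hHD hI h₁ h₃ S h).GU) (v : Fin 2 → ℂ),
      fderiv ℝ
          (fun b : Fin 2 → ℂ =>
            B.thetaFunIn f (y * (thetaSpaceInputIn hHD hI h₁ h₃ S h).ιinf B.Γ₀ (BallForms.expP b))) 0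
          (Complex.I • v) =
        Complex.I •
          fderiv ℝ
            (fun b : Fin 2 → ℂ =>
              B.thetaFunIn f (y * (thetaSpaceInputIn hHD hI h₁ h₃ S h).ιinf B.Γ₀ (BallForms.expP b)))
            0 v) :
    B.restrictedThetaForm f ∈ ((thetaSpaceInputIn hHD hI h₁ h₃ S h).D B.Γ₀).Hol :=
  restrictHom_mem_D_Hol_thetaSpaceInputIn_of_differentiableAt hHD hI h₁ h₃ S h B.Γ₀ B.isLevelCorrected
    B.isWeightMatched (B.thetaFormOf f) hd hlin

/-- **E's `hol` at the pin, per weight function — Lie-derivative shape** (node W6b-hol): for a product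
`K`-type datum `B` over the pinned theta-space input, `B.restrictedThetaForm f ∈ (X.D B.Γ₀).Hol` follows
from archimedean smoothness (`hs`, (AN)) and the Lie-derivative Cauchy–Riemann relation (`hCR`,
annihilation by `𝔭₋`, (REP)+(ASM)) of the components of `B.thetaFunIn f`. -/
theorem ProductKTypeData.restrictedThetaForm_mem_Hol_of_lieDeriv (S : ThetaAdelicSide V c)
    (h : IsAnisotropic L V.Hm) {k : Fin 4} {N : ℕ}
    (B : ProductKTypeData (thetaSpaceInputIn hHD hI h₁ h₃ S h) k N)
    (f : C(relNormOneIdeles (NumberField.maximalRealSubfield L) L ⧸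
      relNormOneRat (NumberField.maximalRealSubfield L) L, ℂ))
    (hs : ∀ j : Fin 2, IsArchSmooth (H := BallForms.u21Group)
      ((thetaSpaceInputIn hHD hI h₁ h₃ S h).ιinf B.Γ₀)
      fun x => B.thetaFunIn f x j)
    (hCR : ∀ (x : (thetaSpaceInputIn hHD hI h₁ h₃ S h).GU) (b : Fin 2 → ℂ) (j : Fin 2),
      lieDeriv (H := BallForms.u21Group) ((thetaSpaceInputIn hHD hI h₁ h₃ S h).ιinf B.Γ₀)
          (BallForms.liePMat (Complex.I • b)) (fun y => B.thetaFunIn f y j) x =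
        Complex.I *
          lieDeriv (H := BallForms.u21Group) ((thetaSpaceInputIn hHD hI h₁ h₃ S h).ιinf B.Γ₀)
            (BallForms.liePMat b) (fun y => B.thetaFunIn f y j) x) :
    B.restrictedThetaForm f ∈ ((thetaSpaceInputIn hHD hI h₁ h₃ S h).D B.Γ₀).Hol :=
  restrictHom_mem_D_Hol_thetaSpaceInputIn hHD hI h₁ h₃ S h B.Γ₀ B.isLevelCorrected B.isWeightMatched
    (B.thetaFormOf f) hs hCR

end PinHol

end Model
end HodgeCM

end
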